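import Summits.Ventures.HodgeRepro2.A2PontryaginLeibniz
import Summits.Ventures.HodgeRepro2.A2HodgeBigrading

/-!
# A2PontryaginContraction — the Pontryagin product with ANY monomial is a contraction operator

Tier-4 annex of sub-claim A2 (seat p6, cell pub-hodge-repro2); §8(d): uses an L-value-free
non-vanishing device: NO.

Row 117 (`pontryagin_ET`): the Pontryagin product with a full-plane monomial is a plane
contraction, `z ⋆ E_T = vol • Λ_{univ ∖ T} z`.  This file proves the general form, for every
generator monomial `mono l` (half planes allowed): `z ⋆ mono l = (ε · vol) • R_{lᶜ} z` with a
sign `ε = ±1` depending on `l` only, where `R_{lᶜ}` is the iterated RIGHT contraction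
(`CliffordAlgebra.contractRight`, `contrR`, `contrRList`) by the duals of the generators NOT in
`l` (`compl l`).  The right contraction is the natural operator here: with p5's left contractions
the sign would depend on the degree of `z` (toy check in the three-generator case), and the bridge
`contrR_eq_of_mem`: `z ⌊ d = −(−1)^i • (d ⌋ z)` on `⋀^i` converts.

Proof: induction on `l` through the Leibniz rule of row 124 (`pontryagin_mul_gen_add`): the
right multiplication by a generator `a` passes through the contraction list up to sign
(`contrRList_mul_gen_of_notMem`, `contrRList_mul_gen_of_mem`), the terms `(R z) ∧ a` cancel
because `|compl l| + |l| = 2|ι|` is even, and the base case is the counit `z ⋆ 1 = (∫ z) • 1`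
matched with `R_{all} z = ε₀ • (∫ z) • 1` (`contrRList_genList`).

What stays prose: that the model's `⋆` is the Pontryagin product of the abelian variety `B`
(A4.1.0 / A4.3.3); nothing here is on the N1 chain.
-/

namespace Summit.Ventures.HodgeRepro2.A2PontryaginContraction

open WeilPlanes WeilIntegral WeilCoproduct A2ModelDuality A2PontryaginModel A2PontryaginLeibniz

variable {ι : Type*} [DecidableEq ι] [Fintype ι]

/-! ### Right contractions -/

omit [DecidableEq ι] [Fintype ι] in
/-- The right contraction `x ↦ x ⌊ d` by a covector `d` (Mathlib's `CliffordAlgebra.contractRight`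
on the exterior algebra), as a linear map. -/
def contrR (d : Module.Dual ℂ (V ι)) : A ι →ₗ[ℂ] A ι :=
  LinearMap.flip (CliffordAlgebra.contractRight (Q := (0 : QuadraticForm ℂ (V ι)))) d

omit [DecidableEq ι] [Fintype ι] in
/-- `contrR d x = x ⌊ d`. -/
theorem contrR_apply (d : Module.Dual ℂ (V ι)) (x : A ι) :
    contrR d x = CliffordAlgebra.contractRight x d := rfl

omit [Fintype ι] in
/-- The right derivation rule on a generator: `(x ∧ a) ⌊ d = d(a) x − (x ⌊ d) ∧ a`
(Mathlib's `contractRight_mul_ι`). -/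
theorem contrR_mul_gen (d : Module.Dual ℂ (V ι)) (x : A ι) (j : Gen ι) :
    contrR d (x * gen j) = d (Pi.single j 1) • x - contrR d x * gen j :=
  CliffordAlgebra.contractRight_mul_ι d (Pi.single j 1) x

omit [DecidableEq ι] [Fintype ι] in
/-- The right derivation rule on a vector: `(x ∧ ι v) ⌊ d = d(v) x − (x ⌊ d) ∧ ι v`. -/
theorem contrR_mul_ι (d : Module.Dual ℂ (V ι)) (x : A ι) (v : V ι) :
    contrR d (x * ExteriorAlgebra.ι ℂ v) = d v • x - contrR d x * ExteriorAlgebra.ι ℂ v :=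
  CliffordAlgebra.contractRight_mul_ι d v x

omit [Fintype ι] in
/-- The right derivation rule for the dual basis: `(x ∧ a_j) ⌊ a_k^* = [k = j] x − (x ⌊ a_k^*) ∧ a_j`. -/
theorem contrR_dual_mul_gen (k j : Gen ι) (x : A ι) :
    contrR (dual k) (x * gen j) = (if k = j then x else 0) - contrR (dual k) x * gen j := by
  rw [contrR_mul_gen, A2HardLefschetzOps.dual_single]
  split_ifs <;> simp

omit [Fintype ι] in
/-- Graded commutation with a vector: `x ∧ ι v = (−1)^k ι v ∧ x` for `x ∈ ⋀^k`. -/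
theorem mul_ι_of_mem (v : V ι) {k : ℕ} {x : A ι} (hx : x ∈ grading ι k) :
    x * ExteriorAlgebra.ι ℂ v = (-1 : ℂ) ^ k • (ExteriorAlgebra.ι ℂ v * x) := by
  refine Submodule.pow_induction_on_left' (LinearMap.range (ExteriorAlgebra.ι ℂ : V ι →ₗ[ℂ] A ι))
    (C := fun n x _ => x * ExteriorAlgebra.ι ℂ v = (-1 : ℂ) ^ n • (ExteriorAlgebra.ι ℂ v * x))
    ?_ ?_ ?_ hx
  · intro r
    simp only [pow_zero, one_smul]
    exact Algebra.commutes r _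
  · intro x y n _ _ hx hy
    simp only [add_mul, mul_add, hx, hy, smul_add]
  · rintro m ⟨w, rfl⟩ n x _ hx
    have h1 : ExteriorAlgebra.ι ℂ w * ExteriorAlgebra.ι ℂ v =
        -(ExteriorAlgebra.ι ℂ v * ExteriorAlgebra.ι ℂ w) :=
      eq_neg_of_add_eq_zero_left (ExteriorAlgebra.ι_add_mul_swap w v)
    calc ExteriorAlgebra.ι ℂ w * x * ExteriorAlgebra.ι ℂ v
        = ExteriorAlgebra.ι ℂ w * ((-1 : ℂ) ^ n • (ExteriorAlgebra.ι ℂ v * x)) := by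
          rw [mul_assoc, hx]
      _ = (-1 : ℂ) ^ n • (ExteriorAlgebra.ι ℂ w * ExteriorAlgebra.ι ℂ v * x) := by
          rw [mul_smul_comm, mul_assoc]
      _ = (-1 : ℂ) ^ (n + 1) • (ExteriorAlgebra.ι ℂ v * (ExteriorAlgebra.ι ℂ w * x)) := by
          rw [h1, neg_mul, smul_neg, pow_succ, mul_neg_one, neg_smul, mul_assoc]

omit [Fintype ι] in
/-- Graded commutation with a vector, the other way: `ι v ∧ x = (−1)^k x ∧ ι v` for `x ∈ ⋀^k`. -/
theorem ι_mul_of_mem (v : V ι) {k : ℕ} {x : A ι} (hx : x ∈ grading ι k) :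
    ExteriorAlgebra.ι ℂ v * x = (-1 : ℂ) ^ k • (x * ExteriorAlgebra.ι ℂ v) := by
  rw [mul_ι_of_mem v hx, smul_smul, ← pow_add, ← two_mul, pow_mul, neg_one_sq, one_pow, one_smul]

omit [Fintype ι] in
/-- THE BRIDGE TO THE LEFT CONTRACTIONS OF p5: on `⋀^i`, `x ⌊ d = −(−1)^i • (d ⌋ x)`. -/
theorem contrR_eq_of_mem (d : Module.Dual ℂ (V ι)) {i : ℕ} {x : A ι} (hx : x ∈ grading ι i) :
    contrR d x = -((-1 : ℂ) ^ i • contr d x) := by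
  refine Submodule.pow_induction_on_left' (LinearMap.range (ExteriorAlgebra.ι ℂ : V ι →ₗ[ℂ] A ι))
    (C := fun n x _ => contrR d x = -((-1 : ℂ) ^ n • contr d x)) ?_ ?_ ?_ hx
  · intro r
    rw [contrR_apply, CliffordAlgebra.contractRight_algebraMap, A2HardLefschetzOps.contr_algebraMap,
      smul_zero, neg_zero]
  · intro x y n _ _ hx hy
    simp only [map_add, hx, hy, smul_add, neg_add]
  · rintro m ⟨v, rfl⟩ n x hxn hx
    have hc : contr d x * ExteriorAlgebra.ι ℂ v =
        -((-1 : ℂ) ^ n • (ExteriorAlgebra.ι ℂ v * contr d x)) := by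
      rcases n with _ | n
      · rw [A2HardLefschetzOps.contr_eq_zero_of_mem_zero d hxn, zero_mul, mul_zero, smul_zero,
          neg_zero]
      · rw [mul_ι_of_mem v (A2HardLefschetzOps.contr_mem_grading d hxn), pow_succ, mul_neg_one,
          neg_smul, neg_neg]
    rw [A2HardLefschetzOps.contr_ι_mul, ι_mul_of_mem v hxn, map_smul, contrR_mul_ι, hx, neg_mul,
      smul_mul_assoc, hc, smul_neg, neg_neg, smul_smul, ← pow_add, ← two_mul, pow_mul, neg_one_sq,
      one_pow, one_smul, pow_succ, mul_neg_one, neg_smul, neg_neg]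

omit [Fintype ι] in
/-- A contraction by the dual of a generator absent from a duplicate-free monomial kills it. -/
theorem contrR_dual_mono_of_notMem {j : Gen ι} {l : List (Gen ι)} (hj : j ∉ l) :
    contrR (dual j) (mono l) = 0 := by
  rw [contrR_eq_of_mem _ (A2HodgeBigrading.mono_mem_grading l), contr_dual_mono_of_notMem hj,
    smul_zero, neg_zero]

omit [Fintype ι] in
/-- A contraction by the dual of a generator of a duplicate-free monomial removes it up to sign. -/
theorem contrR_dual_mono_of_mem {j : Gen ι} {l : List (Gen ι)} (hl : l.Nodup) (hj : j ∈ l) :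
    ∃ ε : ℂ, (ε = 1 ∨ ε = -1) ∧ contrR (dual j) (mono l) = ε • mono (l.erase j) := by
  obtain ⟨ε, hε, h⟩ := contr_dual_mono_of_mem hl hj
  refine ⟨-((-1 : ℂ) ^ l.length * ε), ?_, ?_⟩
  · rcases neg_one_pow_eq_or ℂ l.length with h1 | h1 <;> rcases hε with rfl | rfl <;> simp [h1]
  · rw [contrR_eq_of_mem _ (A2HodgeBigrading.mono_mem_grading l), h, smul_smul, neg_smul]

/-! ### Iterated right contractions along a generator list -/

omit [DecidableEq ι] [Fintype ι] in
/-- The iterated right contraction along a generator list, head first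
(the convention of p5's `contrList`). -/
def contrRList : List (Gen ι) → A ι →ₗ[ℂ] A ι
  | [] => LinearMap.id
  | j :: L => contrRList L ∘ₗ contrR (dual j)

omit [DecidableEq ι] [Fintype ι] in
/-- `contrRList [] = id`. -/
theorem contrRList_nil : contrRList ([] : List (Gen ι)) = LinearMap.id := rfl

omit [DecidableEq ι] [Fintype ι] in
/-- `contrRList (j :: L) = contrRList L ∘ contrR (dual j)`. -/
theorem contrRList_cons (j : Gen ι) (L : List (Gen ι)) :
    contrRList (j :: L) = contrRList L ∘ₗ contrR (dual j) := rfl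

omit [Fintype ι] in
/-- A right multiplication by a generator absent from `L` passes through `contrRList L` with the
sign `(−1)^{|L|}`. -/
theorem contrRList_mul_gen_of_notMem {j : Gen ι} {L : List (Gen ι)} (hj : j ∉ L) (z : A ι) :
    contrRList L (z * gen j) = (-1 : ℂ) ^ L.length • (contrRList L z * gen j) := by
  induction L generalizing z with
  | nil => simp [contrRList_nil]
  | cons k L ih =>
    rw [List.mem_cons, not_or] at hj
    rw [contrRList_cons, LinearMap.comp_apply, LinearMap.comp_apply, contrR_dual_mul_gen,
      if_neg (Ne.symm hj.1), zero_sub, map_neg, ih hj.2, List.length_cons, pow_succ, mul_neg_one,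
      neg_smul]

omit [Fintype ι] in
/-- A right multiplication by a generator PRESENT in the duplicate-free list `L` passes through
`contrRList L` up to the term `± contrRList (L.erase j) z` produced by its own contraction. -/
theorem contrRList_mul_gen_of_mem {j : Gen ι} {L : List (Gen ι)} (hL : L.Nodup) (hj : j ∈ L) :
    ∃ ε : ℂ, (ε = 1 ∨ ε = -1) ∧ ∀ z : A ι, contrRList L (z * gen j) =
      ε • contrRList (L.erase j) z + (-1 : ℂ) ^ L.length • (contrRList L z * gen j) := by
  induction L with
  | nil => exact absurd hj (by simp)
  | cons k L ih =>
    rw [List.nodup_cons] at hL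
    by_cases hkj : k = j
    · subst hkj
      refine ⟨1, Or.inl rfl, fun z => ?_⟩
      rw [List.erase_cons_head, contrRList_cons, LinearMap.comp_apply, LinearMap.comp_apply,
        contrR_dual_mul_gen, if_pos rfl, map_sub, contrRList_mul_gen_of_notMem hL.1,
        List.length_cons, pow_succ, mul_neg_one, neg_smul, one_smul, sub_eq_add_neg]
    · have hjL : j ∈ L := by
        rw [List.mem_cons] at hj
        exact hj.resolve_left (Ne.symm hkj)
      obtain ⟨ε, hε, h⟩ := ih hL.2 hjL
      refine ⟨-ε, ?_, fun z => ?_⟩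
      · rcases hε with rfl | rfl <;> simp
      · rw [List.erase_cons_tail (by simpa using hkj), contrRList_cons, contrRList_cons,
          LinearMap.comp_apply, LinearMap.comp_apply, LinearMap.comp_apply, contrR_dual_mul_gen,
          if_neg hkj, zero_sub, map_neg, h, List.length_cons, pow_succ, mul_neg_one, neg_smul,
          neg_smul, neg_add]

/-! ### The complementary generator list -/

/-- The generators not in `l`, in the order of p5's `genList`. -/
noncomputable def compl (l : List (Gen ι)) : List (Gen ι) := genList.filter fun k => decide (k ∉ l)

omit [DecidableEq ι] in
/-- Every generator lies in `genList`. -/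
theorem mem_genList (j : Gen ι) : j ∈ (genList : List (Gen ι)) := by
  simp [genList, mem_planeList]

omit [DecidableEq ι] in
/-- `genList` has `2|ι|` entries. -/
theorem length_genList : (genList : List (Gen ι)).length = Fintype.card (Gen ι) := by
  simp [genList, planeList, List.length_flatMap]

/-- Membership in the complement. -/
theorem mem_compl {l : List (Gen ι)} {k : Gen ι} : k ∈ compl l ↔ k ∉ l := by
  simp [compl, mem_genList]

/-- The complement is duplicate-free. -/
theorem nodup_compl (l : List (Gen ι)) : (compl l).Nodup :=
  (nodup_planeList _).filter _

/-- `compl [] = genList`. -/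
theorem compl_nil : compl ([] : List (Gen ι)) = genList :=
  List.filter_eq_self.mpr fun _ _ => by simp

/-- `compl (j :: l) = (compl l).erase j`. -/
theorem compl_cons (j : Gen ι) (l : List (Gen ι)) : compl (j :: l) = (compl l).erase j := by
  rw [(nodup_compl l).erase_eq_filter]
  unfold compl
  rw [List.filter_filter]
  refine List.filter_congr fun k _ => ?_
  by_cases hk : k = j <;> simp [hk, List.mem_cons]

/-- `|compl l| + |l| = 2|ι|` for a duplicate-free list `l`. -/
theorem length_compl_add {l : List (Gen ι)} (hl : l.Nodup) :
    (compl l).length + l.length = Fintype.card (Gen ι) := by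
  have h1 := List.length_eq_length_filter_add (l := (genList : List (Gen ι)))
    (fun k => decide (k ∉ l))
  have h2 : (genList.filter fun k => !decide (k ∉ l)).Perm l := by
    refine List.perm_of_nodup_nodup_toFinset_eq ((nodup_planeList _).filter _) hl ?_
    ext k
    simp [mem_genList]
  rw [length_genList, h2.length_eq] at h1
  exact h1.symm

/-- The sign `(−1)^{|compl l|}` equals `(−1)^{|l|}` — the total number of generators is even. -/
theorem neg_one_pow_length_compl {l : List (Gen ι)} (hl : l.Nodup) :
    (-1 : ℂ) ^ (compl l).length = (-1 : ℂ) ^ l.length := by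
  have h := length_compl_add hl
  have hN : Fintype.card (Gen ι) = 2 * Fintype.card ι := A2IntegralDegree.card_gen
  have : (-1 : ℂ) ^ (compl l).length * (-1 : ℂ) ^ l.length = 1 := by
    rw [← pow_add, h, hN, pow_mul, neg_one_sq, one_pow]
  rcases neg_one_pow_eq_or ℂ (compl l).length with h1 | h1 <;>
    rcases neg_one_pow_eq_or ℂ l.length with h2 | h2 <;> simp_all

/-! ### The full right contraction is the integral -/

omit [Fintype ι] in
/-- A right-contraction list containing a generator absent from the duplicate-free monomial
kills it. -/
theorem contrRList_mono_eq_zero (L : List (Gen ι)) {l : List (Gen ι)} (hl : l.Nodup)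
    (h : ∃ j ∈ L, j ∉ l) : contrRList L (mono l) = 0 := by
  induction L generalizing l with
  | nil => obtain ⟨j, hj, -⟩ := h; exact absurd hj (by simp)
  | cons k L ih =>
    rw [contrRList_cons, LinearMap.comp_apply]
    by_cases hk : k ∈ l
    · obtain ⟨ε, -, hε⟩ := contrR_dual_mono_of_mem hl hk
      rw [hε, map_smul]
      obtain ⟨j, hj, hjl⟩ := h
      rw [List.mem_cons] at hj
      have hjL : j ∈ L := hj.resolve_left fun hjk => hjl (by rw [hjk]; exact hk)
      rw [ih (l := l.erase k) (hl.erase k) ⟨j, hjL, fun hj' => hjl (List.mem_of_mem_erase hj')⟩,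
        smul_zero]
    · rw [contrR_dual_mono_of_notMem hk, map_zero]

omit [Fintype ι] in
/-- The right-contraction list along `L ⊆ l` (both duplicate-free) applied to `mono l` is `±` the
monomial of the remaining generators. -/
theorem contrRList_mono_of_subset (L : List (Gen ι)) {l : List (Gen ι)} (hL : L.Nodup)
    (hl : l.Nodup) (h : ∀ j ∈ L, j ∈ l) :
    ∃ ε : ℂ, (ε = 1 ∨ ε = -1) ∧
      contrRList L (mono l) = ε • mono (l.filter fun k => decide (k ∉ L)) := by
  induction L generalizing l with
  | nil =>
    refine ⟨1, Or.inl rfl, ?_⟩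
    rw [contrRList_nil, LinearMap.id_apply, one_smul, List.filter_eq_self.mpr fun _ _ => by simp]
  | cons k L ih =>
    rw [List.nodup_cons] at hL
    have hk : k ∈ l := h k (List.mem_cons_self)
    obtain ⟨ε, hε, hε'⟩ := contrR_dual_mono_of_mem hl hk
    have hsub : ∀ j ∈ L, j ∈ l.erase k := fun j hj =>
      (List.mem_erase_of_ne fun hjk => hL.1 (by rw [← hjk]; exact hj)).mpr
        (h j (List.mem_cons_of_mem k hj))
    obtain ⟨ε', hε'', hε'''⟩ := ih (l := l.erase k) hL.2 (hl.erase k) hsub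
    refine ⟨ε * ε', ?_, ?_⟩
    · rcases hε with rfl | rfl <;> rcases hε'' with rfl | rfl <;> simp
    · rw [contrRList_cons, LinearMap.comp_apply, hε', map_smul, hε''', smul_smul,
        hl.erase_eq_filter, List.filter_filter]
      congr 2
      refine List.filter_congr fun x _ => ?_
      by_cases hx : x = k <;> simp [hx, List.mem_cons]

/-- THE FULL RIGHT CONTRACTION IS THE INTEGRAL: `R_{genList} z = ε₀ • (∫_B z) • 1` for a sign
`ε₀ = ±1` independent of `z`. -/
theorem contrRList_genList :
    ∃ ε₀ : ℂ, (ε₀ = 1 ∨ ε₀ = -1) ∧ ∀ z : A ι, contrRList genList z = ε₀ • integral z • 1 := by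
  -- the value on the top basis monomial
  set s₀ : Finset (Fin (Fintype.card (Gen ι))) := Finset.univ with hs₀
  have hall : ∀ j, j ∈ genListOf s₀ := fun j => (mem_genListOf _ _).mpr (Finset.mem_univ _)
  obtain ⟨ε₁, hε₁, h₁⟩ := contrRList_mono_of_subset genList (nodup_planeList _)
    (A2LamAdjoint.genListOf_nodup s₀) fun j _ => hall j
  obtain ⟨ε₂, hε₂, h₂⟩ := integral_mono_of_forall_mem (A2LamAdjoint.genListOf_nodup s₀) hall
  have hfilt : (genListOf s₀).filter (fun k => decide (k ∉ (genList : List (Gen ι)))) = [] :=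
    List.filter_eq_nil_iff.mpr fun k _ => by simp [mem_genList]
  refine ⟨ε₁ * ε₂, ?_, ?_⟩
  · rcases hε₁ with rfl | rfl <;> rcases hε₂ with rfl | rfl <;> simp
  · -- both sides are linear in `z`; compare on the row-90 basis
    have hlin : (contrRList genList : A ι →ₗ[ℂ] A ι) =
        (ε₁ * ε₂) • (Algebra.linearMap ℂ (A ι) ∘ₗ integral) := by
      refine aBasis.ext fun s => ?_
      rw [LinearMap.smul_apply, LinearMap.comp_apply, Algebra.linearMap_apply, aBasis_apply]
      by_cases hs : s = s₀
      · subst hs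
        have hm : mono ([] : List (Gen ι)) = 1 := by simp [mono]
        rw [h₁, hfilt, h₂, Algebra.algebraMap_eq_smul_one, smul_smul, hm]
        congr 1
        rcases hε₂ with rfl | rfl <;> ring
      · have hne : ∃ j ∈ (genList : List (Gen ι)), j ∉ genListOf s := by
          by_contra hcon
          apply hs
          ext i
          obtain ⟨j, rfl⟩ := enum.surjective i
          simp only [hs₀, Finset.mem_univ, iff_true]
          by_contra hj
          exact hcon ⟨j, mem_genList j, fun h => hj ((mem_genListOf _ _).mp h)⟩
        rw [contrRList_mono_eq_zero _ (A2LamAdjoint.genListOf_nodup s) hne,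
          integral_mono_eq_zero (Or.inr (hne.imp fun j hj => hj.2)), map_zero, smul_zero]
    intro z
    have := LinearMap.congr_fun hlin z
    rw [LinearMap.smul_apply, LinearMap.comp_apply, Algebra.linearMap_apply,
      Algebra.algebraMap_eq_smul_one] at this
    exact this

/-! ### The theorem -/

/-- THE PONTRYAGIN PRODUCT WITH A MONOMIAL IS A CONTRACTION: for every duplicate-free generator
list `l` there is a sign `ε = ±1` with `z ⋆ mono l = (ε · vol) • R_{compl l} z` for EVERY `z`,
`R_{compl l}` = the iterated right contraction by the duals of the generators not in `l`.
(Row 117's `z ⋆ E_T = vol • Λ_{univ∖T} z` is the full-plane case, up to the sign relating the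
right and the left contractions.) -/
theorem pontryagin_mono {l : List (Gen ι)} (hl : l.Nodup) :
    ∃ ε : ℂ, (ε = 1 ∨ ε = -1) ∧
      ∀ z : A ι, pontryagin z (mono l) = (ε * vol ι) • contrRList (compl l) z := by
  induction l with
  | nil =>
    obtain ⟨ε₀, hε₀, h₀⟩ := contrRList_genList (ι := ι)
    obtain ⟨v, hv, hvol⟩ := vol_eq ι
    refine ⟨ε₀ * v, ?_, fun z => ?_⟩
    · rcases hε₀ with rfl | rfl <;> rcases hv with rfl | rfl <;> simp
    · have hmono : mono ([] : List (Gen ι)) = 1 := by simp [mono]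
      rw [hmono, pontryagin_one_eq, compl_nil, h₀, smul_smul, smul_smul, hvol]
      congr 1
      rcases hε₀ with rfl | rfl <;> rcases hv with rfl | rfl <;> ring
  | cons j l ih =>
    rw [List.nodup_cons] at hl
    obtain ⟨ε, hε, h⟩ := ih hl.2
    have hjc : j ∈ compl l := mem_compl.mpr hl.1
    obtain ⟨ε', hε', h'⟩ := contrRList_mul_gen_of_mem (nodup_compl l) hjc
    refine ⟨-(ε' * ε), ?_, fun z => ?_⟩
    · rcases hε with rfl | rfl <;> rcases hε' with rfl | rfl <;> simp
    · -- the Leibniz rule with `x = mono l ∈ ⋀^{|l|}`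
      have hmono : mono (j :: l) = gen j * mono l := by simp [mono]
      have hL := pontryagin_mul_gen_add z (A2HodgeBigrading.mono_mem_grading l) j
      rw [h, h, h', neg_one_pow_length_compl hl.2, smul_add] at hL
      -- `hL : (ε vol) • (ε' • R' z) + (ε vol) • ((−1)^{|l|} • (R z ∧ a)) + z ⋆ (a ∧ mono l)
      --       = (−1)^{|l|} • ((ε vol) • R z ∧ a)` — the two `(R z) ∧ a` terms cancel
      have hcancel : (ε * vol ι) • ((-1 : ℂ) ^ l.length • (contrRList (compl l) z * gen j)) =
          (-1 : ℂ) ^ l.length • ((ε * vol ι) • contrRList (compl l) z * gen j) := by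
        rw [smul_smul, smul_mul_assoc, smul_smul, mul_comm]
      rw [hcancel, add_right_comm] at hL
      have hAP := add_right_cancel (hL.trans (zero_add _).symm)
      have hP := neg_eq_iff_eq_neg.mp (add_eq_zero_iff_eq_neg.mp hAP).symm
      rw [hmono, compl_cons, hP, smul_smul, ← neg_smul]
      congr 1
      ring

end Summit.Ventures.HodgeRepro2.A2PontryaginContraction
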